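import Literature.Combinatorics.Extremal.RuledSurfaceLines
import Mathlib.Combinatorics.Pigeonhole
import HarnessLib

/-!
# Special lines of a ruled surface: at most two

Topic `Literature/Combinatorics/Extremal`. Everything in this file is PROVED.

Let `S = {f = 0} ⊆ K³` be an irreducible surface of degree `d ≥ 3` over an algebraically closed
field which is neither a cone (no point `p` with `f(p + ·)` homogeneous of degree `d`) nor a
cylinder (no direction along which `f` is invariant). A line `ℓ ⊆ S` is *special*
(`IsSpecialLine f ℓ`) when infinitely many lines of `S` are coplanar with it (Guth–Katz's
"exceptional lines", Kollár's "special lines"). The main result `exists_finset_special` is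

> **`S` has at most two special lines** [Kollar2015, Proposition 55 (4)],
> [GuthKatz2015, Corollary 3.6],

proved here WITHOUT the ruled-surface presentation `C ← M → S` of [Kollar2015, §7] and without
the hypothesis "singly ruled" of [GuthKatz2015]: the uniqueness of the ruling through a generic
point is replaced by the crude bound "at most `d(d-1)` lines of `S` through any point of a
non-cone" (`card_lines_through_le`) and a pigeonhole over `2d(d-1)+1` pairwise skew special lines.

The steps:

* `forall_exists_copl_of_special` — [GuthKatz2015, Lemma 3.5 (second part)] in a sharper form:
  if `ℓ` is special then through EVERY point of `S` passes a line of `S` coplanar with `ℓ`.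
  (Elimination theory, `Literature.RingTheory.MvPolynomial.exists_eval_ne_zero_not_hasCommonZero`,
  applied to the Taylor forms `F_1, …, F_d` and the coplanarity form `(x - a)·(u × w)`: the set
  of points of `S` on a line coplanar with `ℓ` is `S` or lies on a second surface, and in the
  latter case only finitely many lines of `S` are coplanar with `ℓ`, by Bézout for lines on two
  surfaces `card_lines_on_two_surfaces_le`.)
* `finite_copl_copl` — two distinct coplanar lines: only finitely many lines of `S` are coplanar
  with both (they pass through the common point, lie in the common plane, or are parallel to one
  of them: `card_lines_through_le`, no plane in `S`, `finite_parallel_lines`).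
  [cite: Kollar2015, Proposition 55, proof of (4) ("any 2 special lines are disjoint")]
* `finite_copl_three` — three pairwise skew lines: only finitely many lines of `S` are coplanar
  with all three (they lie on the quadric through the three lines, `exists_quadric_through_lines`,
  `aeval_line_eq_zero_of_copl_three`). [cite: Kollar2015, Proposition 55, proof of (4)]
  [cite: GuthKatz2015, Corollary 3.6 (proof)]
* `isSpecialLine_of_not_copl` — propagation: if `ℓ` is special and `n ⊆ S` is a line not
  coplanar with `ℓ`, then `n` is special (the lines coplanar with `ℓ` through the points of `n`
  are pairwise distinct and all meet `n`).
* `not_infinite_special_copl` — no line of `S` is coplanar with infinitely many special lines: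
  otherwise pick `2d(d-1)+1` pairwise skew special lines `sᵢ` among them (`exists_skew_finset`);
  through any `x ∈ S` pass lines `mᵢ ∋ x` coplanar with `sᵢ`, at most `d(d-1)` distinct ones, so
  three of the `sᵢ` are coplanar with one line through `x` and the quadric through those three
  vanishes at `x`; hence `f` divides the product of these quadrics — impossible for `d ≥ 3`
  (`false_of_skew_special`).
* `exists_finset_special` — three distinct special lines `ℓ₁, ℓ₂, ℓ₃` would make all but
  finitely many of the (infinitely many) lines coplanar with `ℓ₁` special, by propagation from
  `ℓ₂` or `ℓ₃` and the two finiteness statements; this contradicts the previous step.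

These are the structural facts about ruled surfaces needed for the incidence bound of
[GuthKatz2015, Lemma 3.4] / [Kollar2015, Proposition 55 (5)] (crossing points on a non-special
line, `Literature.Combinatorics.Extremal.card_crossing_le_of_axis`).

## References
* [Kollar2015] J. Kollár, *Szemerédi–Trotter-type theorems in dimension 3*, Adv. Math. 271
  (2015) 30–61, §7 ¶53–54, Proposition 55.
* [GuthKatz2015] L. Guth, N. H. Katz, *On the Erdős distinct distances problem in the plane*,
  Ann. of Math. 181 (2015) 155–190, §3, Lemma 3.5, Corollary 3.6.
-/

namespace Literature.Combinatorics.Extremal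

open MvPolynomial Finset
open scoped Matrix
open Literature.Combinatorics.Additive.DeZeeuw (eq_of_mem_of_mem)
open Literature.RingTheory.MvPolynomial (HasCommonZero exists_eval_ne_zero_not_hasCommonZero)

variable {K : Type*} [Field K]

/-! ### Special lines -/

/-- A line `ℓ` is **special** for the surface `{f = 0}` when infinitely many lines of the surface
are coplanar with it (meet it or are parallel to it). [cite: Kollar2015, §7 ¶54 (special lines)]
[cite: GuthKatz2015, §3 (exceptional lines)] -/
def IsSpecialLine (f : MvPolynomial (Fin 3) K) (ℓ : AffineSubspace K (Fin 3 → K)) : Prop :=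
  Set.Infinite {m | m ∈ linesOn f ∧ Copl ℓ m}

/-! ### Finiteness of families of lines on the surface -/

section Finiteness

/-- **Bézout for lines, set form**: an irreducible surface and a second surface not containing
it have only finitely many lines in common. [folklore] -/
theorem finite_linesOn_of_not_dvd [Infinite K] {f g : MvPolynomial (Fin 3) K}
    (hf : Irreducible f) (hg : ¬ f ∣ g) :
    Set.Finite {m | m ∈ linesOn f ∧ ∀ z ∈ m, eval z g = 0} := by
  by_contra hinf
  obtain ⟨Λ, hΛsub, hΛcard⟩ :=
    Set.Infinite.exists_subset_card_eq hinf (f.totalDegree * g.totalDegree + 1)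
  have h := card_lines_on_two_surfaces_le (hf.isRelPrime_iff_not_dvd.2 hg) Λ
    (fun ℓ hℓ => (hΛsub hℓ).1.1) (fun ℓ hℓ => (hΛsub hℓ).1.2) (fun ℓ hℓ => (hΛsub hℓ).2)
  omega

/-- **Finitely many lines of a non-cone through a point**, set form of
`card_lines_through_le`. [cite: Kollar2015, Proposition 55 (proof, ¶1)] -/
theorem finite_linesOn_through [Infinite K] {f : MvPolynomial (Fin 3) K} (hf : Irreducible f)
    {p : Fin 3 → K} (hcone : ¬ (translate p f).IsHomogeneous f.totalDegree) :
    Set.Finite {m | m ∈ linesOn f ∧ p ∈ m} := by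
  by_contra hinf
  obtain ⟨Λ, hΛsub, hΛcard⟩ :=
    Set.Infinite.exists_subset_card_eq hinf (f.totalDegree * (f.totalDegree - 1) + 1)
  have h := card_lines_through_le hf p hcone Λ (fun ℓ hℓ => (hΛsub hℓ).1.1)
    (fun ℓ hℓ => (hΛsub hℓ).2) (fun ℓ hℓ => (hΛsub hℓ).1.2)
  omega

/-- The affine-linear polynomial `n · (x - a)` of the plane through `a` with normal `n`.
[folklore] -/
noncomputable def planePoly (n a : Fin 3 → K) : MvPolynomial (Fin 3) K :=
  (∑ j, C (n j) * X j) - C (n ⬝ᵥ a)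

/-- `planePoly n a` evaluates to `n · (x - a)`. [folklore] -/
@[simp] theorem eval_planePoly (n a x : Fin 3 → K) : eval x (planePoly n a) = n ⬝ᵥ (x - a) := by
  simp [planePoly, dotProduct, Fin.sum_univ_three]
  ring

/-- `planePoly n a` has degree at most one. [folklore] -/
theorem totalDegree_planePoly_le (n a : Fin 3 → K) : (planePoly n a).totalDegree ≤ 1 := by
  rw [planePoly]
  refine (totalDegree_sub_C_le _ _).trans ?_
  exact (isHomogeneous_linearForm n).totalDegree_le

/-- A polynomial of degree `≥ 2` does not divide a genuine plane equation. [folklore] -/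
theorem not_dvd_planePoly {f : MvPolynomial (Fin 3) K} (hd : 2 ≤ f.totalDegree)
    {n : Fin 3 → K} (hn : n ≠ 0) (a : Fin 3 → K) : ¬ f ∣ planePoly n a := by
  intro h
  have hne : planePoly n a ≠ 0 := by
    obtain ⟨i, hi⟩ := Function.ne_iff.1 hn
    intro h0
    have := congrArg (eval (a + Pi.single i 1)) h0
    rw [eval_planePoly, map_zero, add_sub_cancel_left, dotProduct_single, mul_one] at this
    exact hi this
  have h1 := totalDegree_le_of_dvd_of_isDomain h hne
  have h2 := totalDegree_planePoly_le n a
  omega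

/-- **A point of the surface off a second surface and off finitely many lines.** An irreducible
surface of degree `≥ 2` over an algebraically closed field is not covered by `{c = 0}` (`f ∤ c`)
together with finitely many lines: multiply `c` by one plane equation through each line.
[folklore] -/
theorem exists_point_off_lines [IsAlgClosed K] {f c : MvPolynomial (Fin 3) K}
    (hf : Irreducible f) (hd : 2 ≤ f.totalDegree) (hc : ¬ f ∣ c)
    {Λ : Set (AffineSubspace K (Fin 3 → K))} (hΛ : Λ.Finite)
    (hΛ1 : ∀ m ∈ Λ, Module.finrank K m.direction = 1) :
    ∃ x, eval x f = 0 ∧ eval x c ≠ 0 ∧ ∀ m ∈ Λ, x ∉ m := by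
  classical
  have hlin : ∀ m ∈ Λ, ∃ g : MvPolynomial (Fin 3) K, ¬ f ∣ g ∧ ∀ z ∈ m, eval z g = 0 := by
    intro m hm
    obtain ⟨a, u, hu, rfl⟩ := exists_eq_lineOf m (hΛ1 m hm)
    obtain ⟨n, hn, hnu⟩ := exists_ne_zero_dotProduct_eq_zero u
    refine ⟨planePoly n a, not_dvd_planePoly hd hn a, fun z hz => ?_⟩
    obtain ⟨t, rfl⟩ := mem_lineOf.1 hz
    rw [eval_planePoly, add_sub_cancel_left, dotProduct_smul, hnu, smul_zero]
  choose! g hfg hgm using hlin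
  have hP : ¬ f ∣ c * ∏ m ∈ hΛ.toFinset, g m := by
    intro h
    rcases hf.prime.dvd_or_dvd h with h1 | h1
    · exact hc h1
    · obtain ⟨m, hm, hm'⟩ := hf.prime.exists_mem_finset_dvd h1
      exact hfg m (hΛ.mem_toFinset.1 hm) hm'
  obtain ⟨x, hxf, hxP⟩ := exists_eval_eq_zero_and_ne_zero hf hP
  refine ⟨x, hxf, fun h0 => hxP ?_, fun m hm hxm => hxP ?_⟩
  · rw [map_mul, h0, zero_mul]
  · rw [map_mul, map_prod]
    exact mul_eq_zero_of_right _ (prod_eq_zero (hΛ.mem_toFinset.2 hm) (hgm m hm x hxm))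

end Finiteness

/-! ### Through every point passes a line coplanar with a special line -/

section Elimination

/-- The coplanarity form `(x - a) · (u × w) = w · ((x - a) × u)` of the fixed line `{a + s u}` and
the moving line `{x + t w}`: linear in `w`, coefficients polynomial in `x`. [folklore] -/
noncomputable def coplForm (a u : Fin 3 → K) : MvPolynomial (Fin 3) (MvPolynomial (Fin 3) K) :=
  C ((X 1 - C (a 1)) * C (u 2) - (X 2 - C (a 2)) * C (u 1)) * X 0 +
  C ((X 2 - C (a 2)) * C (u 0) - (X 0 - C (a 0)) * C (u 2)) * X 1 +
  C ((X 0 - C (a 0)) * C (u 1) - (X 1 - C (a 1)) * C (u 0)) * X 2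

/-- The coplanarity form is linear in `w`. [folklore] -/
theorem isHomogeneous_coplForm (a u : Fin 3 → K) : (coplForm a u).IsHomogeneous 1 :=
  (((isHomogeneous_X _ 0).C_mul _).add ((isHomogeneous_X _ 1).C_mul _)).add
    ((isHomogeneous_X _ 2).C_mul _)

/-- The coplanarity form evaluates to `coplDet a u x w`. [folklore] -/
theorem eval_map_coplForm (a u x w : Fin 3 → K) :
    eval w (map (eval x) (coplForm a u)) = coplDet a u x w := by
  simp [coplForm, coplDet, cross_apply, dotProduct, Fin.sum_univ_three]
  ring

/-- **Through every point of the surface passes a line coplanar with a given special line**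
(Guth–Katz's structural lemma for exceptional lines, without exceptional curve). If `f` is
irreducible over an algebraically closed field and infinitely many lines of `{f = 0}` are
coplanar with the line `ℓ`, then every point of `{f = 0}` lies on a line of `{f = 0}` coplanar
with `ℓ`. Proof: "`x` lies on a line of the surface coplanar with `ℓ`" means that the Taylor
forms `F_1(x;·), …, F_d(x;·)` and the coplanarity form have a common nontrivial zero; if this
fails at one point `x₀` of the surface, elimination gives `Δ` with `Δ(x₀) ≠ 0` off whose zero set
it fails too, so all the lines coplanar with `ℓ` lie on `{f = 0} ∩ {Δ = 0}`, `f ∤ Δ`: finitely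
many. [cite: GuthKatz2015, Lemma 3.5] -/
theorem forall_exists_copl_of_special [IsAlgClosed K] {f : MvPolynomial (Fin 3) K}
    (hf : Irreducible f) {ℓ : AffineSubspace K (Fin 3 → K)}
    (hℓ : Module.finrank K ℓ.direction = 1) (hspec : IsSpecialLine f ℓ) {x : Fin 3 → K}
    (hx : eval x f = 0) : ∃ m ∈ linesOn f, x ∈ m ∧ Copl ℓ m := by
  haveI : Infinite K := IsAlgClosed.instInfinite
  obtain ⟨a, u, hu, rfl⟩ := exists_eq_lineOf ℓ hℓ
  set d := f.totalDegree with hd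
  set Gfam : Option (Fin d) → MvPolynomial (Fin 3) (MvPolynomial (Fin 3) K) :=
    fun o => o.elim (coplForm a u) (fun j => taylorForm f (j.1 + 1)) with hGfam
  set efam : Option (Fin d) → ℕ := fun o => o.elim 1 (fun j => j.1 + 1) with hefam
  have hGhom : ∀ o, (Gfam o).IsHomogeneous (efam o) := by
    rintro (_ | j)
    · exact isHomogeneous_coplForm a u
    · exact isHomogeneous_taylorForm f _
  -- common zeros at a point of the surface = lines of the surface through it coplanar with `ℓ`
  have hiff : ∀ y, eval y f = 0 →
      (HasCommonZero Gfam y ↔ ∃ m ∈ linesOn f, y ∈ m ∧ Copl (lineOf a u) m) := by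
    intro y hy
    constructor
    · rintro ⟨w, hw, hG⟩
      have hline : ∀ t : K, eval (y + t • w) f = 0 :=
        (forall_eval_add_smul_iff f hy w).2 fun i hi hid => by
          have := hG (some ⟨i - 1, by omega⟩)
          change eval w (map (eval y) (taylorForm f (i - 1 + 1))) = 0 at this
          rwa [Nat.sub_add_cancel hi] at this
      refine ⟨lineOf y w, (lineOf_mem_linesOn_iff y hw).2 hline, self_mem_lineOf y w, ?_⟩
      rw [copl_lineOf_iff hu hw, ← eval_map_coplForm]
      exact hG none
    · rintro ⟨m, hm, hym, hcop⟩
      obtain ⟨w, hw, rfl⟩ := exists_eq_lineOf_of_mem m hm.1 hym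
      refine ⟨w, hw, ?_⟩
      rintro (_ | j)
      · change eval w (map (eval y) (coplForm a u)) = 0
        rw [eval_map_coplForm, ← copl_lineOf_iff hu hw]
        exact hcop
      · change eval w (map (eval y) (taylorForm f (j.1 + 1))) = 0
        exact (forall_eval_add_smul_iff f hy w).1 ((lineOf_mem_linesOn_iff y hw).1 hm) _
          (Nat.succ_pos _) j.2
  by_contra hno
  have h0 : ¬ HasCommonZero Gfam x := fun h => hno ((hiff x hx).1 h)
  obtain ⟨Δ, hΔx, hΔ⟩ := exists_eval_ne_zero_not_hasCommonZero Gfam efam hGhom h0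
  have hfΔ : ¬ f ∣ Δ := by
    rintro ⟨q, rfl⟩
    rw [map_mul, hx, zero_mul] at hΔx
    exact hΔx rfl
  refine hspec ((finite_linesOn_of_not_dvd hf hfΔ).subset ?_)
  rintro m ⟨hm, hcop⟩
  refine ⟨hm, fun y hy => ?_⟩
  by_contra hy0
  exact hΔ y hy0 ((hiff y (hm.2 y hy)).2 ⟨m, hm, hy, hcop⟩)

end Elimination

/-! ### Lines coplanar with two coplanar lines, or with three skew lines -/

section TwoThree

/-- A common normal vector: for two distinct coplanar lines `{a + s u} ≠ {b + t w}` there is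
`n ≠ 0` orthogonal to `u`, `w` and `b - a` (the normal of their common plane). [folklore] -/
theorem exists_normal_of_copl {a u b w : Fin 3 → K} (hu : u ≠ 0) (hw : w ≠ 0)
    (hne : lineOf a u ≠ lineOf b w) (hcop : Copl (lineOf a u) (lineOf b w)) :
    ∃ n : Fin 3 → K, n ≠ 0 ∧ n ⬝ᵥ u = 0 ∧ n ⬝ᵥ w = 0 ∧ n ⬝ᵥ (b - a) = 0 := by
  have hdet : coplDet a u b w = 0 := (copl_lineOf_iff hu hw).1 hcop
  by_cases hind : LinearIndependent K ![u, w]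
  · refine ⟨u ⨯₃ w, crossProduct_ne_zero_iff_linearIndependent.2 hind, ?_, ?_, ?_⟩
    · rw [dotProduct_comm]; exact dot_self_cross u w
    · rw [dotProduct_comm]; exact dot_cross_self u w
    · rw [dotProduct_comm]; exact hdet
  · obtain ⟨c, rfl⟩ := exists_eq_smul_of_not_linearIndependent hu hind
    by_cases hind' : LinearIndependent K ![u, b - a]
    · refine ⟨u ⨯₃ (b - a), crossProduct_ne_zero_iff_linearIndependent.2 hind', ?_, ?_, ?_⟩
      · rw [dotProduct_comm]; exact dot_self_cross u _
      · rw [dotProduct_smul, dotProduct_comm, dot_self_cross, smul_zero]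
      · rw [dotProduct_comm]; exact dot_cross_self u _
    · exfalso
      obtain ⟨c', hc'⟩ := exists_eq_smul_of_not_linearIndependent hu hind'
      have hc0 : c ≠ 0 := by rintro rfl; exact hw (zero_smul _ _)
      apply hne
      have hb : b = a + c' • u := by rw [← hc']; abel
      rw [hb, lineOf_add_smul_smul a u c' hc0]

/-- **Two distinct coplanar lines: finitely many lines of the surface are coplanar with both.**
On an irreducible surface of degree `≥ 2` over an algebraically closed field which is neither
a cone nor a cylinder, a line of the surface coplanar with both of two distinct coplanar lines
passes through their common point (finitely many, `card_lines_through_le`), or lies in their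
common plane (finitely many, `card_lines_on_two_surfaces_le` with the plane's equation), or is
parallel to one of them (finitely many, `finite_parallel_lines`).
[cite: Kollar2015, Proposition 55, proof of (4)] -/
theorem finite_copl_copl [IsAlgClosed K] {f : MvPolynomial (Fin 3) K} (hf : Irreducible f)
    (hd : 2 ≤ f.totalDegree)
    (hcone : ¬ ∃ p : Fin 3 → K, (translate p f).IsHomogeneous f.totalDegree)
    (hcyl : ¬ ∃ v : Fin 3 → K, v ≠ 0 ∧ ∀ (p : Fin 3 → K) (t : K), eval (p + t • v) f = eval p f)
    {ℓ₁ ℓ₂ : AffineSubspace K (Fin 3 → K)} (h₁ : Module.finrank K ℓ₁.direction = 1)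
    (h₂ : Module.finrank K ℓ₂.direction = 1) (hne : ℓ₁ ≠ ℓ₂) (hcop : Copl ℓ₁ ℓ₂) :
    Set.Finite {m | m ∈ linesOn f ∧ Copl ℓ₁ m ∧ Copl ℓ₂ m} := by
  haveI : Infinite K := IsAlgClosed.instInfinite
  obtain ⟨a, u, hu, rfl⟩ := exists_eq_lineOf ℓ₁ h₁
  obtain ⟨b, w, hw, rfl⟩ := exists_eq_lineOf ℓ₂ h₂
  obtain ⟨n, hn, hnu, hnw, hnba⟩ := exists_normal_of_copl hu hw hne hcop
  -- the four finite families
  have hF₁ := finite_linesOn_of_not_dvd hf (not_dvd_planePoly hd hn a)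
  have hF₂ := finite_parallel_lines hf hcyl hu
  have hF₃ := finite_parallel_lines hf hcyl hw
  have hF₄ : Set.Finite
      {m | m ∈ linesOn f ∧ ∃ z, z ∈ lineOf a u ∧ z ∈ lineOf b w ∧ z ∈ m} := by
    by_cases hz : ∃ z, z ∈ lineOf a u ∧ z ∈ lineOf b w
    · obtain ⟨z₀, hz₀1, hz₀2⟩ := hz
      refine (finite_linesOn_through hf (p := z₀) (fun h => hcone ⟨z₀, h⟩)).subset ?_
      rintro m ⟨hm, z, hz1, hz2, hzm⟩
      exact ⟨hm, eq_of_mem_of_mem (finrank_direction_lineOf a hu) (finrank_direction_lineOf b hw)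
        hne hz1 hz2 hz₀1 hz₀2 ▸ hzm⟩
    · refine Set.finite_empty.subset ?_
      rintro m ⟨-, z, hz1, hz2, -⟩
      exact hz ⟨z, hz1, hz2⟩
  refine (((hF₁.union hF₂).union hF₃).union hF₄).subset ?_
  rintro m ⟨hm, hc1, hc2⟩
  rcases hc1 with ⟨z, hz1, hzm⟩ | hdir1
  swap
  · refine Set.mem_union_left _ (Set.mem_union_left _ (Set.mem_union_right _ ⟨hm, ?_⟩))
    rw [← hdir1, direction_lineOf]
  rcases hc2 with ⟨z', hz'2, hz'm⟩ | hdir2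
  swap
  · refine Set.mem_union_left _ (Set.mem_union_right _ ⟨hm, ?_⟩)
    rw [← hdir2, direction_lineOf]
  by_cases hzz : z = z'
  · subst hzz
    exact Set.mem_union_right _ ⟨hm, z, hz1, hz'2, hzm⟩
  · -- the line through `z ≠ z'` lies in the plane `n · (x - a) = 0`
    refine Set.mem_union_left _ (Set.mem_union_left _ (Set.mem_union_left _ ⟨hm, fun y hy => ?_⟩))
    obtain ⟨v, hv, rfl⟩ := exists_eq_lineOf_of_mem m hm.1 hzm
    obtain ⟨s, hs⟩ := mem_lineOf.1 hz'm
    obtain ⟨t, rfl⟩ := mem_lineOf.1 hy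
    have hza : n ⬝ᵥ (z - a) = 0 := by
      obtain ⟨t₁, rfl⟩ := mem_lineOf.1 hz1
      rw [add_sub_cancel_left, dotProduct_smul, hnu, smul_zero]
    have hz'a : n ⬝ᵥ (z' - a) = 0 := by
      obtain ⟨t₂, rfl⟩ := mem_lineOf.1 hz'2
      have : b + t₂ • w - a = (b - a) + t₂ • w := by abel
      rw [this, dotProduct_add, dotProduct_smul, hnba, hnw, smul_zero, add_zero]
    have hs0 : s ≠ 0 := by
      rintro rfl
      exact hzz (by rw [hs, zero_smul, add_zero])
    have hnv : n ⬝ᵥ v = 0 := by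
      rw [hs] at hz'a
      have : z + s • v - a = (z - a) + s • v := by abel
      rw [this, dotProduct_add, dotProduct_smul, hza, zero_add, smul_eq_mul] at hz'a
      exact (mul_eq_zero.1 hz'a).resolve_left hs0
    rw [eval_planePoly]
    have : z + t • v - a = (z - a) + t • v := by abel
    rw [this, dotProduct_add, dotProduct_smul, hza, hnv, smul_zero, add_zero]

/-- The regulus argument for three explicit pairwise skew lines on a quadric `{G = 0}`,
`deg G ≤ 2`: a line `{b + t w}` coplanar with each of them lies on the quadric, in particular
`G(b) = 0`. [cite: GuthKatz2015, §3, proof of Corollary 3.6]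
[cite: Kollar2015, Proposition 55, proof of (4)] -/
theorem eval_eq_zero_of_copl_three (G : MvPolynomial (Fin 3) K) (hG2 : G.totalDegree ≤ 2)
    {a₁ u₁ a₂ u₂ a₃ u₃ : Fin 3 → K}
    (h₁ : aeval (fun j => Polynomial.C (a₁ j) + Polynomial.C (u₁ j) * Polynomial.X) G = 0)
    (h₂ : aeval (fun j => Polynomial.C (a₂ j) + Polynomial.C (u₂ j) * Polynomial.X) G = 0)
    (h₃ : aeval (fun j => Polynomial.C (a₃ j) + Polynomial.C (u₃ j) * Polynomial.X) G = 0)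
    (h₁₂ : ¬ Copl (lineOf a₁ u₁) (lineOf a₂ u₂)) (h₁₃ : ¬ Copl (lineOf a₁ u₁) (lineOf a₃ u₃))
    (h₂₃ : ¬ Copl (lineOf a₂ u₂) (lineOf a₃ u₃))
    {b w : Fin 3 → K} (hw : w ≠ 0) (hc₁ : Copl (lineOf a₁ u₁) (lineOf b w))
    (hc₂ : Copl (lineOf a₂ u₂) (lineOf b w)) (hc₃ : Copl (lineOf a₃ u₃) (lineOf b w)) :
    eval b G = 0 := by
  have key := aeval_line_eq_zero_of_copl_three G hG2 ![a₁, a₂, a₃] ![u₁, u₂, u₃]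
    (by intro i; fin_cases i <;> simpa)
    (by
      intro i j hij
      fin_cases i <;> fin_cases j
      · exact absurd rfl hij
      · simpa using h₁₂
      · simpa using h₁₃
      · simpa using fun h => h₁₂ (Copl.symm h)
      · exact absurd rfl hij
      · simpa using h₂₃
      · simpa using fun h => h₁₃ (Copl.symm h)
      · simpa using fun h => h₂₃ (Copl.symm h)
      · exact absurd rfl hij)
    hw (by intro i; fin_cases i <;> simpa)
  have := congrArg (Polynomial.eval 0) key
  rwa [eval_aeval_line, Polynomial.eval_zero, zero_smul, add_zero] at this

/-- **Three pairwise skew lines: finitely many lines of the surface are coplanar with all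
three** (on an irreducible surface of degree `≥ 3` over an infinite field): they lie on the
quadric through the three lines, which does not contain the surface.
[cite: Kollar2015, Proposition 55, proof of (4)] [cite: GuthKatz2015, Corollary 3.6 (proof)] -/
theorem finite_copl_three [Infinite K] {f : MvPolynomial (Fin 3) K} (hf : Irreducible f)
    (hd3 : 3 ≤ f.totalDegree) {a₁ u₁ a₂ u₂ a₃ u₃ : Fin 3 → K}
    (h₁₂ : ¬ Copl (lineOf a₁ u₁) (lineOf a₂ u₂)) (h₁₃ : ¬ Copl (lineOf a₁ u₁) (lineOf a₃ u₃))
    (h₂₃ : ¬ Copl (lineOf a₂ u₂) (lineOf a₃ u₃)) :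
    Set.Finite {m | m ∈ linesOn f ∧ Copl (lineOf a₁ u₁) m ∧ Copl (lineOf a₂ u₂) m ∧
      Copl (lineOf a₃ u₃) m} := by
  classical
  obtain ⟨G, hG0, hG2, hGT⟩ := exists_quadric_through_lines
    ({(a₁, u₁), (a₂, u₂), (a₃, u₃)} : Finset ((Fin 3 → K) × (Fin 3 → K))) card_le_three
  have hfG : ¬ f ∣ G := fun h => by
    have := totalDegree_le_of_dvd_of_isDomain h hG0
    omega
  refine (finite_linesOn_of_not_dvd hf hfG).subset ?_
  rintro m ⟨hm, hc1, hc2, hc3⟩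
  refine ⟨hm, fun z hz => ?_⟩
  obtain ⟨w, hw, rfl⟩ := exists_eq_lineOf_of_mem m hm.1 hz
  exact eval_eq_zero_of_copl_three G hG2 (hGT (a₁, u₁) (by simp)) (hGT (a₂, u₂) (by simp))
    (hGT (a₃, u₃) (by simp)) h₁₂ h₁₃ h₂₃ hw hc1 hc2 hc3

end TwoThree

/-! ### Propagation of specialness and the main lemma -/

section Main

/-- **Propagation.** If through every point of the surface passes a line of the surface
coplanar with `ℓ` (e.g. `ℓ` special, `forall_exists_copl_of_special`) and the line `n` of the
surface is NOT coplanar with `ℓ`, then `n` is special: the lines coplanar with `ℓ` through the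
points of `n` differ from `n`, hence are pairwise distinct, and all meet `n`.
[cite: GuthKatz2015, §3, proof of Corollary 3.6] -/
theorem isSpecialLine_of_not_copl [Infinite K] {f : MvPolynomial (Fin 3) K}
    {ℓ : AffineSubspace K (Fin 3 → K)}
    (hℓ : ∀ x, eval x f = 0 → ∃ m ∈ linesOn f, x ∈ m ∧ Copl ℓ m)
    {n : AffineSubspace K (Fin 3 → K)} (hn : n ∈ linesOn f) (hnc : ¬ Copl ℓ n) :
    IsSpecialLine f n := by
  obtain ⟨c, v, hv, rfl⟩ := exists_eq_lineOf n hn.1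
  have hpt : ∀ t : K, ∃ m ∈ linesOn f, c + t • v ∈ m ∧ Copl ℓ m :=
    fun t => hℓ _ (hn.2 _ (add_smul_mem_lineOf c v t))
  choose m hm hmem hcop using hpt
  have hne : ∀ t, m t ≠ lineOf c v := fun t h => hnc (h ▸ hcop t)
  refine Set.infinite_of_injective_forall_mem (f := m) (fun t t' htt => ?_)
    fun t => ⟨hm t, Or.inl ⟨c + t • v, add_smul_mem_lineOf c v t, hmem t⟩⟩
  by_contra hne'
  have h1 := eq_of_mem_of_mem (hm t).1 (finrank_direction_lineOf c hv) (hne t) (hmem t)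
    (add_smul_mem_lineOf c v t) (by rw [htt]; exact hmem t') (add_smul_mem_lineOf c v t')
  have h2 : (t - t') • v = 0 := by
    rw [sub_smul]
    exact sub_eq_zero.2 (add_left_cancel h1)
  exact hne' (sub_eq_zero.1 ((smul_eq_zero.1 h2).resolve_right hv))

/-- **Extraction of pairwise skew lines.** From an infinite family `A` of lines of the surface,
all coplanar with a fixed line `ℓ₀` of the surface, one can extract any number of pairwise
non-coplanar members other than `ℓ₀` (each member is coplanar with only finitely many others,
by `finite_copl_copl` for the pair member/`ℓ₀`). [folklore] -/
theorem exists_skew_finset [IsAlgClosed K] {f : MvPolynomial (Fin 3) K} (hf : Irreducible f)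
    (hd : 2 ≤ f.totalDegree)
    (hcone : ¬ ∃ p : Fin 3 → K, (translate p f).IsHomogeneous f.totalDegree)
    (hcyl : ¬ ∃ v : Fin 3 → K, v ≠ 0 ∧ ∀ (p : Fin 3 → K) (t : K), eval (p + t • v) f = eval p f)
    {ℓ₀ : AffineSubspace K (Fin 3 → K)} (hℓ₀ : ℓ₀ ∈ linesOn f)
    {A : Set (AffineSubspace K (Fin 3 → K))} (hA : A.Infinite) (hAon : ∀ m ∈ A, m ∈ linesOn f)
    (hAcop : ∀ m ∈ A, Copl ℓ₀ m) (n : ℕ) :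
    ∃ F : Finset (AffineSubspace K (Fin 3 → K)), ↑F ⊆ A ∧ ℓ₀ ∉ F ∧ F.card = n ∧
      ∀ s ∈ F, ∀ s' ∈ F, s ≠ s' → ¬ Copl s s' := by
  classical
  induction n with
  | zero => exact ⟨∅, by simp, by simp, rfl, by simp⟩
  | succ n ih =>
    obtain ⟨F, hFA, hℓ₀F, hcard, hskew⟩ := ih
    set Bad : Set (AffineSubspace K (Fin 3 → K)) := {ℓ₀} ∪ (↑F ∪
      ⋃ s ∈ (↑F : Set (AffineSubspace K (Fin 3 → K))),
        {m | m ∈ linesOn f ∧ Copl s m ∧ Copl ℓ₀ m}) with hBad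
    have hbad : Bad.Finite := by
      refine (Set.finite_singleton _).union (F.finite_toSet.union
        (F.finite_toSet.biUnion fun s hs => ?_))
      have hsA := hFA hs
      exact finite_copl_copl hf hd hcone hcyl (hAon _ hsA).1 hℓ₀.1 (fun h => hℓ₀F (h ▸ hs))
        (hAcop _ hsA).symm
    obtain ⟨m, hmA, hmbad⟩ := (hA.sdiff hbad).nonempty
    have hmℓ₀ : m ≠ ℓ₀ := fun h => hmbad (Set.mem_union_left _ h)
    have hmF : m ∉ F := fun h => hmbad (Set.mem_union_right _ (Set.mem_union_left _ h))
    have hmcop : ∀ s ∈ F, ¬ Copl s m := fun s hs h =>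
      hmbad (Set.mem_union_right _ (Set.mem_union_right _
        (Set.mem_iUnion₂.2 ⟨s, hs, hAon _ hmA, h, hAcop _ hmA⟩)))
    refine ⟨insert m F, ?_, ?_, ?_, ?_⟩
    · rw [coe_insert]
      exact Set.insert_subset hmA hFA
    · rw [mem_insert, not_or]
      exact ⟨Ne.symm hmℓ₀, hℓ₀F⟩
    · rw [card_insert_of_notMem hmF, hcard]
    · intro s hs s' hs' hss'
      rw [mem_insert] at hs hs'
      rcases hs with rfl | hs <;> rcases hs' with rfl | hs'
      · exact absurd rfl hss'
      · exact fun h => hmcop s' hs' h.symm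
      · exact hmcop s hs
      · exact hskew s hs s' hs' hss'

/-- **The pigeonhole.** More than `2d(d-1)` pairwise skew special lines of an irreducible
non-cone of degree `d ≥ 3` are impossible: through a point `x` of the surface pass at most
`d(d-1)` lines (`card_lines_through_le`) but, for each special `sᵢ`, one coplanar with `sᵢ`
(`forall_exists_copl_of_special`); so one line through `x` is coplanar with three of the `sᵢ`
and the quadric through them vanishes at `x` (`eval_eq_zero_of_copl_three`). Thus `f` divides
the product of the quadrics through the triples — impossible in degree `≥ 3`.
[cite: Kollar2015, Proposition 55 (4) (proof: "every ruling meets Q in at least 3 points")] -/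
theorem false_of_skew_special [IsAlgClosed K] {f : MvPolynomial (Fin 3) K} (hf : Irreducible f)
    (hd3 : 3 ≤ f.totalDegree)
    (hcone : ¬ ∃ p : Fin 3 → K, (translate p f).IsHomogeneous f.totalDegree)
    (F : Finset (AffineSubspace K (Fin 3 → K))) (hFon : ∀ s ∈ F, s ∈ linesOn f)
    (hFspec : ∀ s ∈ F, IsSpecialLine f s)
    (hskew : ∀ s ∈ F, ∀ s' ∈ F, s ≠ s' → ¬ Copl s s')
    (hcard : 2 * (f.totalDegree * (f.totalDegree - 1)) < F.card) : False := by
  classical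
  haveI : Infinite K := IsAlgClosed.instInfinite
  set N := f.totalDegree * (f.totalDegree - 1) with hN
  -- parametrize the lines of `F`
  have hpar : ∀ s ∈ F, ∃ au : (Fin 3 → K) × (Fin 3 → K), au.2 ≠ 0 ∧ s = lineOf au.1 au.2 := by
    intro s hs
    obtain ⟨a, u, hu, h⟩ := exists_eq_lineOf s (hFon s hs).1
    exact ⟨(a, u), hu, h⟩
  choose! au hau0 hau using hpar
  -- a quadric through each triple
  have hquad : ∀ τ : AffineSubspace K (Fin 3 → K) × AffineSubspace K (Fin 3 → K) ×
      AffineSubspace K (Fin 3 → K), ∃ G : MvPolynomial (Fin 3) K, G ≠ 0 ∧ G.totalDegree ≤ 2 ∧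
        ∀ l ∈ ({au τ.1, au τ.2.1, au τ.2.2} : Finset ((Fin 3 → K) × (Fin 3 → K))),
          aeval (fun i => Polynomial.C (l.1 i) + Polynomial.C (l.2 i) * Polynomial.X) G = 0 :=
    fun τ => exists_quadric_through_lines _ card_le_three
  choose G hG0 hG2 hGT using hquad
  -- their product vanishes on the surface
  have hvan : ∀ x, eval x f = 0 → eval x (∏ τ ∈ F ×ˢ (F ×ˢ F), G τ) = 0 := by
    intro x hx
    have hconex : ¬ (translate x f).IsHomogeneous f.totalDegree := fun h => hcone ⟨x, h⟩
    have hfin := finite_linesOn_through hf hconex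
    have hcardx : hfin.toFinset.card ≤ N :=
      card_lines_through_le hf x hconex _ (fun m hm => (hfin.mem_toFinset.1 hm).1.1)
        (fun m hm => (hfin.mem_toFinset.1 hm).2) (fun m hm => (hfin.mem_toFinset.1 hm).1.2)
    have hch : ∀ s ∈ F, ∃ m ∈ linesOn f, x ∈ m ∧ Copl s m :=
      fun s hs => forall_exists_copl_of_special hf (hFon s hs).1 (hFspec s hs) hx
    choose! φ hφon hφx hφcop using hch
    have hmaps : ∀ s ∈ F, φ s ∈ hfin.toFinset :=
      fun s hs => hfin.mem_toFinset.2 ⟨hφon s hs, hφx s hs⟩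
    obtain ⟨y, hy, hfib⟩ :=
      Finset.exists_lt_card_fiber_of_mul_lt_card_of_maps_to hmaps (n := 2) (by omega)
    obtain ⟨s₁, s₂, s₃, hs₁, hs₂, hs₃, h12, h13, h23⟩ := two_lt_card_iff.1 hfib
    rw [mem_filter] at hs₁ hs₂ hs₃
    obtain ⟨hymem, hxy⟩ := hfin.mem_toFinset.1 hy
    obtain ⟨v, hv, hyv⟩ := exists_eq_lineOf_of_mem y hymem.1 hxy
    rw [map_prod]
    refine prod_eq_zero (i := (s₁, s₂, s₃))
      (mem_product.2 ⟨hs₁.1, mem_product.2 ⟨hs₂.1, hs₃.1⟩⟩) ?_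
    have hsk : ∀ {s s' : AffineSubspace K (Fin 3 → K)}, s ∈ F → s' ∈ F → s ≠ s' →
        ¬ Copl (lineOf (au s).1 (au s).2) (lineOf (au s').1 (au s').2) := by
      intro s s' hs hs' hss'
      rw [← hau s hs, ← hau s' hs']
      exact hskew s hs s' hs' hss'
    have hcp : ∀ {s : AffineSubspace K (Fin 3 → K)}, s ∈ F → φ s = y →
        Copl (lineOf (au s).1 (au s).2) (lineOf x v) := by
      intro s hs hsy
      rw [← hau s hs, ← hyv, ← hsy]
      exact hφcop s hs
    exact eval_eq_zero_of_copl_three (G (s₁, s₂, s₃)) (hG2 _)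
      (hGT (s₁, s₂, s₃) (au s₁) (by simp)) (hGT (s₁, s₂, s₃) (au s₂) (by simp))
      (hGT (s₁, s₂, s₃) (au s₃) (by simp))
      (hsk hs₁.1 hs₂.1 h12) (hsk hs₁.1 hs₃.1 h13) (hsk hs₂.1 hs₃.1 h23) hv
      (hcp hs₁.1 hs₁.2) (hcp hs₂.1 hs₂.2) (hcp hs₃.1 hs₃.2)
  obtain ⟨τ, -, hτ⟩ := hf.prime.exists_mem_finset_dvd (dvd_of_forall_eval_eq_zero hf hvan)
  have := totalDegree_le_of_dvd_of_isDomain hτ (hG0 τ)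
  have := hG2 τ
  omega

/-- **No line of the surface is coplanar with infinitely many special lines** (irreducible,
degree `≥ 3`, neither a cone nor a cylinder, algebraically closed field): extract
`2d(d-1)+1` pairwise skew ones and apply the pigeonhole. [cite: Kollar2015, Proposition 55 (4)] -/
theorem not_infinite_special_copl [IsAlgClosed K] {f : MvPolynomial (Fin 3) K}
    (hf : Irreducible f) (hd3 : 3 ≤ f.totalDegree)
    (hcone : ¬ ∃ p : Fin 3 → K, (translate p f).IsHomogeneous f.totalDegree)
    (hcyl : ¬ ∃ v : Fin 3 → K, v ≠ 0 ∧ ∀ (p : Fin 3 → K) (t : K), eval (p + t • v) f = eval p f)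
    {ℓ₀ : AffineSubspace K (Fin 3 → K)} (hℓ₀ : ℓ₀ ∈ linesOn f)
    (hA : Set.Infinite {m | m ∈ linesOn f ∧ Copl ℓ₀ m ∧ IsSpecialLine f m}) : False := by
  obtain ⟨F, hFA, -, hcard, hskew⟩ := exists_skew_finset hf (by omega) hcone hcyl hℓ₀ hA
    (fun m hm => hm.1) (fun m hm => hm.2.1) (2 * (f.totalDegree * (f.totalDegree - 1)) + 1)
  exact false_of_skew_special hf hd3 hcone F (fun s hs => (hFA hs).1)
    (fun s hs => (hFA hs).2.2) hskew (by omega)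

end Main

/-! ### At most two special lines -/

section AtMostTwo

/-- **Two distinct coplanar special lines are impossible**: all but finitely many of the
infinitely many lines coplanar with `ℓ₁` are not coplanar with `ℓ₂` (`finite_copl_copl`), hence
special by propagation from `ℓ₂` — contradicting `not_infinite_special_copl`.
[cite: Kollar2015, Proposition 55, proof of (4) ("any 2 special lines are disjoint")] -/
theorem false_of_copl_special [IsAlgClosed K] {f : MvPolynomial (Fin 3) K}
    (hf : Irreducible f) (hd3 : 3 ≤ f.totalDegree)
    (hcone : ¬ ∃ p : Fin 3 → K, (translate p f).IsHomogeneous f.totalDegree)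
    (hcyl : ¬ ∃ v : Fin 3 → K, v ≠ 0 ∧ ∀ (p : Fin 3 → K) (t : K), eval (p + t • v) f = eval p f)
    {ℓ₁ ℓ₂ : AffineSubspace K (Fin 3 → K)} (h₁ : ℓ₁ ∈ linesOn f) (h₂ : ℓ₂ ∈ linesOn f)
    (hs₁ : IsSpecialLine f ℓ₁) (hs₂ : IsSpecialLine f ℓ₂) (hne : ℓ₁ ≠ ℓ₂) (hcop : Copl ℓ₁ ℓ₂) :
    False := by
  haveI : Infinite K := IsAlgClosed.instInfinite
  refine not_infinite_special_copl hf hd3 hcone hcyl h₁ ?_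
  have hP := finite_copl_copl hf (by omega) hcone hcyl h₁.1 h₂.1 hne hcop
  refine (Set.Infinite.sdiff hs₁ hP).mono ?_
  rintro m ⟨⟨hm, hc1⟩, hnot⟩
  exact ⟨hm, hc1, isSpecialLine_of_not_copl
    (fun x hx => forall_exists_copl_of_special hf h₂.1 hs₂ hx) hm fun hc2 => hnot ⟨hm, hc1, hc2⟩⟩

/-- **Three pairwise skew special lines are impossible**: all but finitely many of the lines
coplanar with `ℓ₁` are not coplanar with both `ℓ₂` and `ℓ₃` (`finite_copl_three`), hence
special by propagation from `ℓ₂` or `ℓ₃` — contradicting `not_infinite_special_copl`.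
[cite: Kollar2015, Proposition 55, proof of (4)] [cite: GuthKatz2015, Corollary 3.6] -/
theorem false_of_three_skew_special [IsAlgClosed K] {f : MvPolynomial (Fin 3) K}
    (hf : Irreducible f) (hd3 : 3 ≤ f.totalDegree)
    (hcone : ¬ ∃ p : Fin 3 → K, (translate p f).IsHomogeneous f.totalDegree)
    (hcyl : ¬ ∃ v : Fin 3 → K, v ≠ 0 ∧ ∀ (p : Fin 3 → K) (t : K), eval (p + t • v) f = eval p f)
    {ℓ₁ ℓ₂ ℓ₃ : AffineSubspace K (Fin 3 → K)} (h₁ : ℓ₁ ∈ linesOn f) (h₂ : ℓ₂ ∈ linesOn f)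
    (h₃ : ℓ₃ ∈ linesOn f) (hs₁ : IsSpecialLine f ℓ₁) (hs₂ : IsSpecialLine f ℓ₂)
    (hs₃ : IsSpecialLine f ℓ₃) (h₁₂ : ¬ Copl ℓ₁ ℓ₂) (h₁₃ : ¬ Copl ℓ₁ ℓ₃) (h₂₃ : ¬ Copl ℓ₂ ℓ₃) :
    False := by
  haveI : Infinite K := IsAlgClosed.instInfinite
  have h₂' := h₂
  have h₃' := h₃
  obtain ⟨a₁, u₁, hu₁, rfl⟩ := exists_eq_lineOf ℓ₁ h₁.1
  obtain ⟨a₂, u₂, hu₂, rfl⟩ := exists_eq_lineOf ℓ₂ h₂.1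
  obtain ⟨a₃, u₃, hu₃, rfl⟩ := exists_eq_lineOf ℓ₃ h₃.1
  refine not_infinite_special_copl hf hd3 hcone hcyl h₁ ?_
  have hR := finite_copl_three hf hd3 h₁₂ h₁₃ h₂₃
  refine (Set.Infinite.sdiff hs₁ hR).mono ?_
  rintro m ⟨⟨hm, hc1⟩, hnot⟩
  refine ⟨hm, hc1, ?_⟩
  by_cases hc2 : Copl (lineOf a₂ u₂) m
  · by_cases hc3 : Copl (lineOf a₃ u₃) m
    · exact absurd ⟨hm, hc1, hc2, hc3⟩ hnot
    · exact isSpecialLine_of_not_copl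
        (fun x hx => forall_exists_copl_of_special hf h₃'.1 hs₃ hx) hm hc3
  · exact isSpecialLine_of_not_copl
      (fun x hx => forall_exists_copl_of_special hf h₂'.1 hs₂ hx) hm hc2

/-- Three distinct special lines are impossible. [cite: Kollar2015, Proposition 55 (4)] -/
theorem false_of_three_special [IsAlgClosed K] {f : MvPolynomial (Fin 3) K}
    (hf : Irreducible f) (hd3 : 3 ≤ f.totalDegree)
    (hcone : ¬ ∃ p : Fin 3 → K, (translate p f).IsHomogeneous f.totalDegree)
    (hcyl : ¬ ∃ v : Fin 3 → K, v ≠ 0 ∧ ∀ (p : Fin 3 → K) (t : K), eval (p + t • v) f = eval p f)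
    {ℓ₁ ℓ₂ ℓ₃ : AffineSubspace K (Fin 3 → K)} (h₁ : ℓ₁ ∈ linesOn f) (h₂ : ℓ₂ ∈ linesOn f)
    (h₃ : ℓ₃ ∈ linesOn f) (hs₁ : IsSpecialLine f ℓ₁) (hs₂ : IsSpecialLine f ℓ₂)
    (hs₃ : IsSpecialLine f ℓ₃) (h12 : ℓ₁ ≠ ℓ₂) (h13 : ℓ₁ ≠ ℓ₃) (h23 : ℓ₂ ≠ ℓ₃) : False := by
  by_cases hc12 : Copl ℓ₁ ℓ₂
  · exact false_of_copl_special hf hd3 hcone hcyl h₁ h₂ hs₁ hs₂ h12 hc12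
  by_cases hc13 : Copl ℓ₁ ℓ₃
  · exact false_of_copl_special hf hd3 hcone hcyl h₁ h₃ hs₁ hs₃ h13 hc13
  by_cases hc23 : Copl ℓ₂ ℓ₃
  · exact false_of_copl_special hf hd3 hcone hcyl h₂ h₃ hs₂ hs₃ h23 hc23
  exact false_of_three_skew_special hf hd3 hcone hcyl h₁ h₂ h₃ hs₁ hs₂ hs₃ hc12 hc13 hc23

/-- **A ruled surface has at most two special lines** [Kollar2015, Proposition 55 (4)],
[GuthKatz2015, Corollary 3.6], in the form: for an irreducible `f ∈ K[x,y,z]` of degree `≥ 3`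
over an algebraically closed field, `{f = 0}` neither a cone nor a cylinder, there is a set `E`
of at most two lines containing every special line of the surface. (No ruledness hypothesis is
needed: a surface with finitely many lines has no special line.)
[cite: Kollar2015, Proposition 55 (4)] [cite: GuthKatz2015, Corollary 3.6] -/
theorem exists_finset_special [IsAlgClosed K] {f : MvPolynomial (Fin 3) K}
    (hf : Irreducible f) (hd3 : 3 ≤ f.totalDegree)
    (hcone : ¬ ∃ p : Fin 3 → K, (translate p f).IsHomogeneous f.totalDegree)
    (hcyl : ¬ ∃ v : Fin 3 → K, v ≠ 0 ∧ ∀ (p : Fin 3 → K) (t : K), eval (p + t • v) f = eval p f) :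
    ∃ E : Finset (AffineSubspace K (Fin 3 → K)), E.card ≤ 2 ∧
      ∀ ℓ ∈ linesOn f, IsSpecialLine f ℓ → ℓ ∈ E := by
  classical
  by_cases h1 : ∃ ℓ₁ ∈ linesOn f, IsSpecialLine f ℓ₁
  swap
  · push Not at h1
    exact ⟨∅, by simp, fun ℓ hℓ hs => absurd hs (h1 ℓ hℓ)⟩
  obtain ⟨ℓ₁, hℓ₁, hs₁⟩ := h1
  by_cases h2 : ∃ ℓ₂ ∈ linesOn f, IsSpecialLine f ℓ₂ ∧ ℓ₂ ≠ ℓ₁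
  swap
  · push Not at h2
    refine ⟨{ℓ₁}, by simp, fun ℓ hℓ hs => ?_⟩
    rw [mem_singleton]
    exact h2 ℓ hℓ hs
  obtain ⟨ℓ₂, hℓ₂, hs₂, h21⟩ := h2
  refine ⟨{ℓ₁, ℓ₂}, card_le_two, fun ℓ hℓ hs => ?_⟩
  rw [mem_insert, mem_singleton]
  by_contra hno
  push Not at hno
  exact false_of_three_special hf hd3 hcone hcyl hℓ₁ hℓ₂ hℓ hs₁ hs₂ hs h21.symm (Ne.symm hno.1)
    (Ne.symm hno.2)

end AtMostTwo

end Literature.Combinatorics.Extremal
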